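import Summits.ResolutionOfSingularities.ResolutionOfSingularities.Statement
import Summits.ResolutionOfSingularities.ResolutionOfSingularities.Theorems.FrobeniusLadderFRationalResolutionStubsOfHasResolution
import Summits.ResolutionOfSingularities.ResolutionOfSingularities.Theorems.FrobeniusLadderFRationalResolutionQuotientModelOfHasResolution
import Mathlib.AlgebraicGeometry.Morphisms.Etale
import HarnessLib

/-!
# Crux `FRationalResolution`, line `redirect`: all four registered stubs are consequences of the summit (NECESSARY direction)

Support file for crux stmt-ResolutionOfSingularities-15317 (`FrobeniusLadder.FRationalResolution`), skeleton of record
31452a5ba582e46f (line `redirect`). KILL-CRITERION / decomposition bookkeeping, packaging `…StubsOfHasResolution.lean` (p805910) and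
`…QuotientModelOfHasResolution.lean` (p806918): each of the four registered open stubs of the line, with its binder list VERBATIM
(hypotheses that are not needed are kept, underscored), follows from the summit `ResolutionOfSingularities` — the first three
because their conclusions hold along any resolution of `X`, the fourth (`stub_diagonalizableQuotientResolution`, which concludes
`Scheme.HasResolution X` and quantifies over fields of EVERY characteristic, including `0`) from the summit together with the
named fact `Hironaka1964` for the characteristic-`0` fields it also covers. Hence no stub of the line is refutable short of
`¬ResolutionOfSingularities` (resp. `¬Hironaka1964`); in the decomposition vocabulary all four are WEAKER-than-summit pieces.

* `stub_spreadOut_of_summit`, `stub_isolatedFRegularization_of_summit`, `stub_quotientModel_of_summit`,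
  `stub_diagonalizableQuotientResolution_of_summit_of_hironaka`.
[folklore; the summit and `Hironaka1964` enter as hypotheses, nothing is claimed about them]
-/

-- single-problem summit: the doubled namespace component is forced
set_option linter.dupNamespace false

noncomputable section

open CategoryTheory AlgebraicGeometry TopologicalSpace
open Literature.AlgebraicGeometry.Resolution

namespace Summit.ResolutionOfSingularities.ResolutionOfSingularities.Theorems.FRationalResolution

/-- **`stub_spreadOut` ⟸ summit** (binders of the registered stub verbatim; `hFR` unused): a resolution of `X` is the model
(`spreadOut_of_hasResolution`). [folklore] -/
theorem stub_spreadOut_of_summit (hRoS : _root_.ResolutionOfSingularities) (p : ℕ) (hp : p.Prime) (k : Type) [Field k] [CharP k p] (X : Scheme.{0}) (f : X ⟶ Spec (.of k)) [IsSeparated f] [LocallyOfFiniteType f] [QuasiCompact f] [IsIntegral X] (_hFR : ∀ x : X, IsDomain (X.presheaf.stalk x) ∧ ∀ d : ℕ, ringKrullDim (X.presheaf.stalk x) = d → ∀ s : Fin d → X.presheaf.stalk x, (Ideal.span (Set.range s)).radical.IsMaximal → ∀ y c : X.presheaf.stalk x, c ≠ 0 → (∀ e : ℕ, c * y ^ p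 ^ e ∈ Ideal.span ((fun z : X.presheaf.stalk x => z ^ p ^ e) '' (Ideal.span (Set.range s) : Set (X.presheaf.stalk x)))) → y ∈ Ideal.span (Set.range s)) :
    ∃ (X' : Scheme.{0}) (π : X' ⟶ X), IsProper π ∧ IsBirational π ∧ IsIntegral X' ∧ (∀ x : X', IsDomain (X'.presheaf.stalk x) ∧ ∀ d : ℕ, ringKrullDim (X'.presheaf.stalk x) = d → ∀ s : Fin d → X'.presheaf.stalk x, (Ideal.span (Set.range s)).radical.IsMaximal → ∀ y c : X'.presheaf.stalk x, c ≠ 0 → (∀ e : ℕ, c * y ^ p ^ e ∈ Ideal.span ((fun z : X'.presheaf.stalk x => z ^ p ^ e) '' (Ideal.span (Set.range s) : Set (X'.presheaf.stalk x)))) → y ∈ Ideal.span (Set.range s)) ∧ Set.Finite {x : X' | ¬ ((∀ I : Ideal (X'.presheaf.stalk x), ∀ y c : X'.presheaf.stalk x, c ≠ 0 → (∀ e : ℕ, c * y ^ p ^ e ∈ Ideal.span ((fun z : X'.presheaf.stalk x => z ^ p ^ e) '' (I : Set (X'.presheaf.stalk x)))) → y ∈ I) ∨ (∀ d : ℕ,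 ringKrullDim (X'.presheaf.stalk x) = d → ∀ s : Fin d → X'.presheaf.stalk x, (Ideal.span (Set.range s)).radical.IsMaximal → ∃ t : X'.presheaf.stalk x, (Ideal.span (Set.range s)).colon (IsLocalRing.maximalIdeal (X'.presheaf.stalk x) : Set (X'.presheaf.stalk x)) = Ideal.span (Set.range s) ⊔ Ideal.span {t}))} :=
  spreadOut_of_hasResolution p hp k X f (hRoS p hp k X f ‹_› ‹_› ‹_› inferInstance)

/-- **`stub_isolatedFRegularization` ⟸ summit** (binders verbatim; `hFR`, `hfin` unused): a resolution of `X` is the model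
(`isolatedFRegularization_of_hasResolution`). [folklore] -/
theorem stub_isolatedFRegularization_of_summit (hRoS : _root_.ResolutionOfSingularities) (p : ℕ) (hp : p.Prime) (k : Type) [Field k] [CharP k p] (X : Scheme.{0}) (f : X ⟶ Spec (.of k)) [IsSeparated f] [LocallyOfFiniteType f] [QuasiCompact f] [IsIntegral X] (_hFR : ∀ x : X, IsDomain (X.presheaf.stalk x) ∧ ∀ d : ℕ, ringKrullDim (X.presheaf.stalk x) = d → ∀ s : Fin d → X.presheaf.stalk x, (Ideal.span (Set.range s)).radical.IsMaximal → ∀ y c : X.presheaf.stalk x, c ≠ 0 → (∀ e : ℕ, c * y ^ p ^ e ∈ Ideal.span ((fun z : X.presheaf.stalk x => z ^ p ^ e) '' (Ideal.span (Set.range s) : Set (X.presheaf.stalk x)))) → y ∈ Ideal.span (Set.range s)) (_hfin : Set.Finite {x : X | ¬ (∀ I : Ideal (X.presheaf.stalk x), ∀ y c : X.presheaf.stalk x, c ≠ 0 → (∀ e : ℕ, c * y ^ p ^ e ∈ Ideal.span ((fun z : X.presheaf.stalk x => z ^ p ^ e) '' (I : Set (X.presheaf.stalk x)))) → y ∈ I)})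 :
    ∃ (X' : Scheme.{0}) (π : X' ⟶ X), IsProper π ∧ IsBirational π ∧ ∀ x : X', IsDomain (X'.presheaf.stalk x) ∧ ∀ I : Ideal (X'.presheaf.stalk x), ∀ y c : X'.presheaf.stalk x, c ≠ 0 → (∀ e : ℕ, c * y ^ p ^ e ∈ Ideal.span ((fun z : X'.presheaf.stalk x => z ^ p ^ e) '' (I : Set (X'.presheaf.stalk x)))) → y ∈ I :=
  isolatedFRegularization_of_hasResolution p hp k X f (hRoS p hp k X f ‹_› ‹_› ‹_› inferInstance)

/-- **`stub_quotientModel` ⟸ summit** (binders verbatim; `hW` unused): a resolution of `X` is the model, with trivially graded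
affine regular charts (`quotientModel_of_hasResolution`). [folklore] -/
theorem stub_quotientModel_of_summit (hRoS : _root_.ResolutionOfSingularities) (p : ℕ) (hp : p.Prime) (k : Type) [Field k] [CharP k p] (X : Scheme.{0}) (f : X ⟶ Spec (.of k)) [IsSeparated f] [LocallyOfFiniteType f] [QuasiCompact f] [IsIntegral X] (_hW : ∀ x : X, IsDomain (X.presheaf.stalk x) ∧ ∀ I : Ideal (X.presheaf.stalk x), ∀ y c : X.presheaf.stalk x, c ≠ 0 → (∀ e : ℕ, c * y ^ p ^ e ∈ Ideal.span ((fun z : X.presheaf.stalk x => z ^ p ^ e) '' (I : Set (X.presheaf.stalk x)))) → y ∈ I) :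
    ∃ (X' : Scheme.{0}) (π : X' ⟶ X), IsProper π ∧ IsBirational π ∧ IsIntegral X' ∧ ∀ x : X', ∃ (A : Type) (_ : AddCommGroup A) (_ : Finite A) (_ : DecidableEq A) (S : Type) (_ : CommRing S) (_ : Algebra k S) (𝒮 : A → Submodule k S) (_ : GradedAlgebra 𝒮), Algebra.FiniteType k S ∧ IsRegularRing S ∧ ∃ φ : Spec (.of (𝒮 0)) ⟶ X', Etale φ ∧ x ∈ Set.range φ ∧ φ ≫ π ≫ f = Spec.map (CommRingCat.ofHom (algebraMap k (𝒮 0))) :=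
  quotientModel_of_hasResolution k X f (hRoS p hp k X f ‹_› ‹_› ‹_› inferInstance)

/-- **`stub_diagonalizableQuotientResolution` ⟸ summit ∧ Hironaka** (binders verbatim; `hq` unused). The stub concludes
`Scheme.HasResolution X` for an integral separated finite-type `X` over a field `k` of ANY characteristic: for `char k = p` prime
this is the summit, for `char k = 0` it is the named fact `Hironaka1964` (`CharP.exists`, `CharP.char_is_prime_or_zero`).
[folklore] -/
theorem stub_diagonalizableQuotientResolution_of_summit_of_hironaka (hRoS : _root_.ResolutionOfSingularities)
    (hH : Hironaka1964.{0}) (k : Type) [Field k] (X : Scheme.{0}) (g : X ⟶ Spec (.of k)) [IsIntegral X] [IsSeparated g] [LocallyOfFiniteType g] [QuasiCompact g] (_hq : ∀ x : X, ∃ (A : Type) (_ : AddCommGroup A) (_ : Finite A) (_ : DecidableEq A) (S : Type) (_ : CommRing S) (_ : Algebra k S) (𝒮 : A → Submodule k S) (_ : GradedAlgebra 𝒮), Algebra.FiniteType k S ∧ IsRegularRing S ∧ ∃ φ : Spec (.of (𝒮 0)) ⟶ X, Etale φ ∧ x ∈ Set.range φ ∧ φ ≫ g = Spec.map (CommRingCat.ofHom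 (algebraMap k (𝒮 0)))) :
    Scheme.HasResolution X := by
  obtain ⟨p, hpk⟩ := CharP.exists k
  rcases CharP.char_is_prime_or_zero k p with hp | hp
  · exact hRoS p hp k X g ‹_› ‹_› ‹_› inferInstance
  · subst hp
    exact hH k X g ‹_› ‹_› ‹_› inferInstance

end Summit.ResolutionOfSingularities.ResolutionOfSingularities.Theorems.FRationalResolution

end
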